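import Mathlib
import Summits.ValiantsHypothesis.ValiantsHypothesis.Theorems.NewtonUnitEquationsTwoProductsPlanarCellRelationBlocksGlobal
import Summits.ValiantsHypothesis.ValiantsHypothesis.Theorems.NewtonUnitEquationsTwoProductsPlanarCellBlockMerge
import HarnessLib

/-!
# Crux `TwoProducts` (stmt-ValiantsHypothesis-5906): relation blocks AFTER a lattice-small block contraction
# (the genuine-relation analogue of relation_ladder's R5 «merged permutation type»)

Helper mode (`--supports stmt-ValiantsHypothesis-5906 --as helper`; val-lit-p3 g14, KEEP lineage).  Contract a block of positions
`J₀ ∋ j₀` whose block sumset has `≤ M` points (`merge` / `mergeA`, landed port p607798 of val-idea-8 g2's relation_ladder v4):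
`W` is unchanged (`tailDiff_merge`), valid weights stay valid (`validWeight_merge`), the merged tail support has `≤ M + m s` points
(`card_tailSupport_merge_le`).  If the MERGED letter family `mergeA A J₀ j₀` satisfies the per-position relation-blocks hypothesis
of `planarCell_relationBlocks` with `r` blocks, then GLOBALLY every finite set of visible points of `W` has
`≤ 18((M + m s)² + 1) · 2(m+1)(3(2+m+C(m,2))²)^r` points (`visible_global_of_mergedRelationBlocks`).  `r = 0` (merged family
dissociated) contains the confined block law R2⁺ with exponent `2` in the cell count; genuine relations SURVIVING the contraction
are what this corollary adds.
Honest framing: a helper corollary outside any cone of the OPEN crux line; the residual, `PlanarCellBound`, the crux `TwoProducts`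
and `VP ≠ VNP` are OPEN and NOT claimed; no summit statement is proved here.  No instances, no notation, no named facts. [folklore]
-/

noncomputable section

-- Sub = Summit single-conjunct layout: the duplicated namespace component is mandated by the tree.
set_option linter.dupNamespace false

open scoped BigOperators
open MvPolynomial
open Summit.ValiantsHypothesis.ValiantsHypothesis.Theorems.NewtonUnitEquations.TwoProducts.FormalLogLinearisation

namespace Summit.ValiantsHypothesis.ValiantsHypothesis.Theorems.NewtonUnitEquations.TwoProducts.PlanarCell

variable {m : ℕ}

/-- **MERGED RELATION BLOCKS ⇒ GLOBAL COUNT.**  Tails in `A_j ∌ 0` with `#A_j ≤ s`; a block `J₀ ∋ j₀` with block sumset in `≤ M`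
points; if the merged letter family `mergeA A J₀ j₀` satisfies the relation-blocks hypothesis with `r` blocks, then every finite set
of visible points of `W = ∏(1+u_j) − ∏(1+v_j)` has at most `18((M + m s)² + 1) · 2(m+1)(3(2+m+C(m,2))²)^r` points. [folklore] -/
theorem visible_global_of_mergedRelationBlocks (u v : Fin m → MvPolynomial (Fin 2) ℂ) (A : Fin m → Finset Expo) (s M : ℕ)
    (hA0 : ∀ j, (0 : Expo) ∉ A j) (hAs : ∀ j, (A j).card ≤ s)
    (huA : ∀ j, (u j).support ⊆ A j) (hvA : ∀ j, (v j).support ⊆ A j)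
    (J₀ : Finset (Fin m)) (j₀ : Fin m) (hj₀ : j₀ ∈ J₀) (hB : BlockSmall A J₀ M)
    {r : ℕ} (Jc : Fin r → Finset (Fin m)) (ac bc : Fin r → Fin m → Expo)
    (hSR : ∀ a ∈ tuples (mergeA A J₀ j₀), ∀ b ∈ tuples (mergeA A J₀ j₀), a ≠ b → ∑ j, a j = ∑ j, b j → ∀ i, a i ≠ b i →
      ∃ k : Fin r, i ∈ Jc k ∧
        ((∀ j ∈ Jc k, a j = ac k j ∧ b j = bc k j) ∨ (∀ j ∈ Jc k, a j = bc k j ∧ b j = ac k j)))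
    (S : Finset Expo) (hS : ∀ l ∈ S, ∃ ξ : Fin 2 → ℝ, ValidWeight u v ξ ∧ IsStrictTop ξ ↑(tailDiff u v).support l) :
    S.card ≤ 18 * ((M + m * s) ^ 2 + 1) * (2 * (m + 1) * (3 * (2 + m + m.choose 2) ^ 2) ^ r) := by
  have hu0 : ∀ j, coeff 0 (u j) = 0 := fun j => notMem_support_iff.1 fun h => hA0 j (huA j h)
  have hv0 : ∀ j, coeff 0 (v j) = 0 := fun j => notMem_support_iff.1 fun h => hA0 j (hvA j h)
  set u' := merge u J₀ j₀ with hu'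
  set v' := merge v J₀ j₀ with hv'
  have hA0' : ∀ j, (0 : Expo) ∉ mergeA A J₀ j₀ j := zero_not_mem_mergeA A J₀ j₀ hA0
  have huA' : ∀ j, (u' j).support ⊆ mergeA A J₀ j₀ j := support_merge_subset u A J₀ j₀ hj₀ hA0 huA
  have hvA' : ∀ j, (v' j).support ⊆ mergeA A J₀ j₀ j := support_merge_subset v A J₀ j₀ hj₀ hA0 hvA
  -- visible points of `W` are visible points of the merged instance (same `W`, weights stay valid)
  have hS' : ∀ l ∈ S, ∃ ξ : Fin 2 → ℝ, ValidWeight u' v' ξ ∧ IsStrictTop ξ ↑(tailDiff u' v').support l := by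
    intro l hl
    obtain ⟨ξ, hval, htop⟩ := hS l hl
    refine ⟨ξ, validWeight_merge u v J₀ j₀ hj₀ hu0 hv0 hval, ?_⟩
    rw [hu', hv', tailDiff_merge u v J₀ j₀ hj₀]
    exact htop
  have h1 := visible_global_of_relationBlocks u' v' (mergeA A J₀ j₀) hA0' huA' hvA' Jc ac bc hSR S hS'
  have hT : (tailSupport u' v').card ≤ M + m * s := card_tailSupport_merge_le u v A J₀ j₀ hj₀ hA0 huA hvA M s hAs hB
  have hT2 : (tailSupport u' v').card ^ 2 + 1 ≤ (M + m * s) ^ 2 + 1 :=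
    Nat.add_le_add_right (Nat.pow_le_pow_left hT 2) 1
  exact h1.trans (Nat.mul_le_mul_right _ (Nat.mul_le_mul_left 18 hT2))

end Summit.ValiantsHypothesis.ValiantsHypothesis.Theorems.NewtonUnitEquations.TwoProducts.PlanarCell

end
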